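import Mathlib
import Literature.Geometry.Lorentzian.KerrSchild
import Literature.Geometry.Lorentzian.KerrGeodesicTeukolskyFluxes

/-!
# Sketch — crux-ideate round 2, ideator 4, crux stmt-FinalStateConjecture-17402
(`EIHFluxBalance.ModulatedKerrHandoff`, H′)

First lemmas of the idea card `curvature-first-cesaro-volterra` ("curvature first, metric by
Cesàro–Volterra: the cone weight 7/4 is the curvature-order threshold 15/4").

* `CurvatureFirst.FermiConeReconstruction` — the flat, linearised RECONSTRUCTION LEMMA with cone
  weights: a symmetric 2-tensor field `k` on the solid late cone `{1 ≤ x⁰, |x̲| ≤ κ x⁰} ⊂ E4` whose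
  linearised Riemann tensor about Minkowski (tree: `MetricCoord.linRiemannAt`) decays, with three
  derivatives, at order `q` in lab time differs from a pure-gauge tensor `L_Y η` by a field decaying
  at order `q − 2` (with three derivatives, each derivative gaining one order) on every smaller cone.
  Mechanism: linearised Fermi gauge about the lab time axis (curvature sampled on the same slab,
  lever arm `|x̲|² ≤ κ² t²`), plus `ker linRiem_η = im (Y ↦ L_Y η)` on star-shaped regions
  (Saint-Venant / Calabi). Loss of EXACTLY two orders: this is what turns the crux's metric-level
  weight exponent 7/4 into the curvature-level threshold 15/4 = 7/4 + 2.
* `CurvatureFirst.thresholds` — the order bookkeeping the card rests on, as checkable arithmetic: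
  hyperbolic cross terms (order 4) and the printed linear curvature tails (order 7 for the
  linearised Weyl components of compactly supported perturbations: Ma–Zhang arXiv:2104.13809
  Thm 1.1 on Schwarzschild, Millet arXiv:2302.06946 Cor 8.5 leading profile on sub-extremal Kerr;
  Millet's printed remainder class still certifies order 4− in the self-similar zone) clear 15/4;
  parabolic cross terms (order 11/3) and un-trimmed data tails (order 1 + α + 2, α < 3/4) do not.
-/

noncomputable section

open scoped ContDiff Topology
open Literature.Geometry.Lorentzian

namespace Summit.FinalStateConjecture.FinalStateConjecture.Cruxes.ModulatedKerrHandoff.CurvatureFirst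

/-- Component `(α β γ δ)` of the linearised Riemann tensor ABOUT MINKOWSKI of the symmetric
2-tensor field `k : E4 → Bil`, at the point `y`, as a real function of `y` (so that `iteratedFDeriv`
applies). -/
def linRiemComp (k : E4 → E4 →L[ℝ] E4 →L[ℝ] ℝ) (α β γ δ : Fin 4) (y : E4) : ℝ :=
  MetricCoord.linRiemannAt (fun _ : E4 ↦ Minkowski.bilin) k y
    (E4.basisVector α) (E4.basisVector β) (E4.basisVector γ) (E4.basisVector δ)

/-- Component `(α β)` of `k − L_Y η` at `y`, as a real function of `y`:
`k_y(e_α, e_β) − (η(DY_y e_α, e_β) + η(e_α, DY_y e_β))`. -/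
def gaugeResidualComp (k : E4 → E4 →L[ℝ] E4 →L[ℝ] ℝ) (Y : E4 → E4) (α β : Fin 4) (y : E4) : ℝ :=
  k y (E4.basisVector α) (E4.basisVector β) -
    (Minkowski.bilin (fderiv ℝ Y y (E4.basisVector α)) (E4.basisVector β) +
      Minkowski.bilin (E4.basisVector α) (fderiv ℝ Y y (E4.basisVector β)))

/-- The solid late cone of aperture `κ`: `{y : 1 ≤ y⁰ ∧ |y̲| ≤ κ y⁰}`. -/
def lateCone (κ : ℝ) : Set E4 := {y | 1 ≤ y 0 ∧ E4.spatialNorm y ≤ κ * y 0}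

/-- **First lemma (Fermi / Cesàro–Volterra reconstruction with cone weights).** For apertures
`0 < κ' < κ < 1`, an order `q`, and a `C⁵` symmetric 2-tensor field `k` on `E4` whose linearised
Riemann tensor about `η` satisfies `|∂ʲ linRiem[k]| ≤ A (y⁰)^{−q−j}` on the late cone of aperture
`κ` for `j ≤ 3`, there is a smooth vector field `Y` with
`|∂ᵐ (k − L_Y η)| ≤ C A (y⁰)^{2−q−m}` on the late cone of aperture `κ'` for `m ≤ 3`, the constant
`C` depending only on `(κ, κ', q)`. (Flat linear model of the card's synthesis step; the loss of
two orders is sharp for homogeneous curvature tails.) -/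
def FermiConeReconstruction : Prop :=
  ∀ (κ κ' q : ℝ), 0 < κ' → κ' < κ → κ < 1 →
    ∃ C : ℝ, 0 ≤ C ∧
      ∀ (k : E4 → E4 →L[ℝ] E4 →L[ℝ] ℝ) (A : ℝ),
        ContDiff ℝ 5 k → (∀ y v w, k y v w = k y w v) → 0 ≤ A →
        (∀ (j : ℕ), j ≤ 3 → ∀ (α β γ δ : Fin 4), ∀ y ∈ lateCone κ,
            ‖iteratedFDeriv ℝ j (linRiemComp k α β γ δ) y‖ ≤ A * (y 0) ^ (-(q + j))) →
        ∃ Y : E4 → E4, ContDiff ℝ 4 Y ∧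
          ∀ (m : ℕ), m ≤ 3 → ∀ (α β : Fin 4), ∀ y ∈ lateCone κ',
            ‖iteratedFDeriv ℝ m (gaugeResidualComp k Y α β) y‖ ≤ C * A * (y 0) ^ (2 - q - m)

/-- **Order bookkeeping of the card** (pure arithmetic, the numbers that make the lever bite on
THIS crux): the metric weight exponent `p = 7/4` of clause (11) becomes the curvature threshold
`p + 2 = 15/4`; hyperbolically receding cross terms (`M²/(D d³)` with `D ≍ t`: order 4) CLEAR it
with margin `1/4`, and the printed linear curvature tails of compactly supported perturbations
(linearised Weyl components `≍ τ⁻⁷` on `r ≤ τ^{1−ε₀}`, Ma–Zhang arXiv:2104.13809 Thm 1.1; leading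
profile homogeneous of degree `−3−2|s| = −7` on sub-extremal Kerr, Millet arXiv:2302.06946 Cor 8.5,
with printed remainder class of order `4−` in the self-similar zone) clear it by a wide margin;
parabolic cross terms (`D ≍ t^{2/3}`: order `3 + 2/3 = 11/3`) and the curvature of an
un-trimmed admissible tail `h ∼ r^{−1−α}`, `α < 3/4` (order `3 + α`) do NOT — reproducing the
parabolic wall (Disproof §9 item 10′) and the tail stratum (§9 item 1) as one inequality each. -/
theorem thresholds :
    (7 / 4 : ℝ) + 2 = 15 / 4 ∧ (15 / 4 : ℝ) < 4 ∧ (15 / 4 : ℝ) < 7 ∧ (11 / 3 : ℝ) < 15 / 4 ∧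
      ∀ α : ℝ, α < 3 / 4 → 3 + α < 15 / 4 := by
  refine ⟨by norm_num, by norm_num, by norm_num, by norm_num, fun α hα ↦ by linarith⟩

end Summit.FinalStateConjecture.FinalStateConjecture.Cruxes.ModulatedKerrHandoff.CurvatureFirst

end
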